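import Literature.Analysis.FluidPDE.DynamicRescalingBKM
import HarnessLib

/-!
# The vorticity rate of a dynamic-rescaling blow-up: `C_ω(τ) ≍ T − t(τ)`

Topic `Literature/Analysis/FluidPDE`; companion of `DynamicRescalingBlowup.lean` (blow-up at
`T = t(∞)` from a rescaled LOWER bound) and `DynamicRescalingBKM.lean` (the BKM integral). This
file supplies the UPPER half of the bookkeeping, i.e. the *rate* at which a dynamic-rescaling
(modulation) blow-up happens in physical time, which neither file records:

In the convention of [ChenHou2021Boundary] §4.1 (4.1)–(4.3) and Chen–Hou Part I
(arXiv:2210.07191) §2.1 (2.6)–(2.9) — `ω̃(x, τ) = C_ω(τ) ω(C_l(τ) x, t(τ))`,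
`C_ω(τ) = exp ∫₀^τ c_ω`, `t(τ) = ∫₀^τ C_ω`, `T = t(∞)` — one has `C_ω' = c_ω C_ω`, hence for an
exponent pinched away from zero, `−b ≤ c_ω(s) ≤ −a < 0` on `[0, ∞)`,

  `C_ω(τ) = ∫_τ^∞ (−c_ω) C_ω ∈ [a, b] · ∫_τ^∞ C_ω = [a, b] · (T − t(τ))`     (`τ ≥ 0`).

Consequently a rescaled profile that stays BOUNDED, `‖ω̃(τ)‖ = C_ω(τ) ‖ω(t(τ))‖ ≤ M`, blows up
in physical time at most at the self-similar ("Type I in vorticity") rate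
`(T − t) ‖ω(t)‖ ≤ M / a` on `[0, T)`, and one that stays NONTRIVIAL, `‖ω̃(τ)‖ ≥ m > 0`, blows up
at least at that rate, `(T − t) ‖ω(t)‖ ≥ m / b`. This is the elementary fact behind the remark
that every Chen–Hou-type certificate with bounded rescaled profile and `c_ω < 0` lands in the
vorticity-rate class `(T − t) ‖ω(t)‖_∞ ≤ C` (route CertifiedBlowup of NavierStokesRegularity,
cruxes `CertifiedBlowupVorticityRateBlowup` / `…Exclusion`; informal item
stmt-NavierStokesRegularity-0269), stated here once in the tree's vocabulary
(`rescalingFactor`, `rescaledTime`, `blowupTime`) and in the filter shape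
`∀ᶠ t in 𝓝[<] T, ∀ x, (T − t) * ‖curl (u t) x‖ ≤ C` used by those decls.

## What is proved (all `theorem`s, no named facts)

* `hasDerivAt_rescalingFactor`: `C_ω' = c_ω C_ω`; `tendsto_rescalingFactor_atTop`: `C_ω → 0`;
* `blowupTime_sub_rescaledTime`: `T − t(τ) = ∫_{(τ, ∞)} C` (`τ ≥ 0`);
* `rescalingFactor_eq_integral_Ioi`: `C_ω(τ) = ∫_{(τ, ∞)} (−c_ω) C_ω` (`τ ≥ 0`);
* `mul_sub_rescaledTime_le_rescalingFactor` / `rescalingFactor_le_mul_sub_rescaledTime`: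
  `a (T − t(τ)) ≤ C_ω(τ) ≤ b (T − t(τ))`;
* physical-time transfer: `sub_mul_le_of_rescaling` (upper rate on `[0, T)`),
  `eventually_sub_mul_le_of_rescaling` (its `𝓝[<] T` form), `vorticityRate_of_rescaling` (the
  route's conjunct `∃ C, ∀ᶠ t in 𝓝[<] T, ∀ x, (T − t) * ‖curl (u t) x‖ ≤ C`), and
  `le_sub_mul_of_rescaling` (lower rate at the tracked points).

Mathlib supplies the improper-integral FTC (`integral_Ioi_of_hasDerivAt_of_nonpos'`,
`integrableOn_Ioi_deriv_of_nonpos'`, `intervalIntegral.integral_Ioi_sub_Ioi`); nothing here is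
specific to a fluid equation.
-/

noncomputable section

open MeasureTheory Set Filter intervalIntegral
open _root_.Topology

namespace Literature.Analysis.FluidPDE

/-! ### Calculus of the rescaling factor -/

section Factor

variable {c : ℝ → ℝ}

/-- `C_ω'(τ) = c_ω(τ) C_ω(τ)` for a continuous exponent (chain rule on `exp ∫₀^τ c_ω`;
[ChenHou2021Boundary] §4.1 (4.3)). [folklore] -/
theorem hasDerivAt_rescalingFactor (hc : Continuous c) (τ : ℝ) :
    HasDerivAt (rescalingFactor c) (c τ * rescalingFactor c τ) τ := by
  have h : rescalingFactor c = fun u => Real.exp (∫ s in (0 : ℝ)..u, c s) := rfl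
  rw [h]
  simpa [mul_comm] using ((hc.integral_hasStrictDerivAt 0 τ).hasDerivAt).exp

/-- `C_ω(τ) → 0` as `τ → ∞` when `c_ω ≤ −a < 0` on `[0, ∞)` (squeeze with `e^{−aτ}`).
[folklore] -/
theorem tendsto_rescalingFactor_atTop (hc : Continuous c) {a : ℝ} (ha : 0 < a)
    (hca : ∀ s, 0 ≤ s → c s ≤ -a) : Tendsto (rescalingFactor c) atTop (𝓝 0) := by
  have hexp : Tendsto (fun τ => Real.exp (-a * τ)) atTop (𝓝 0) := by
    have h := Real.tendsto_exp_neg_atTop_nhds_zero.comp (tendsto_id.const_mul_atTop ha)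
    refine h.congr' (Eventually.of_forall fun τ => ?_)
    simp [neg_mul]
  refine tendsto_of_tendsto_of_tendsto_of_le_of_le' tendsto_const_nhds hexp
    (Eventually.of_forall fun τ => (rescalingFactor_pos c τ).le) ?_
  filter_upwards [eventually_ge_atTop 0] with τ hτ using rescalingFactor_le_exp_neg hc hca hτ

/-- `c_ω C_ω ≤ 0` on `[0, ∞)` when `c_ω ≤ −a < 0` there. [folklore] -/
theorem mul_rescalingFactor_nonpos {a : ℝ} (ha : 0 < a) (hca : ∀ s, 0 ≤ s → c s ≤ -a)
    {s : ℝ} (hs : 0 ≤ s) : c s * rescalingFactor c s ≤ 0 :=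
  mul_nonpos_of_nonpos_of_nonneg ((hca s hs).trans (by linarith)) (rescalingFactor_pos c s).le

/-- `c_ω C_ω = C_ω'` is integrable on `(τ, ∞)` for `τ ≥ 0` (a nonpositive derivative of a function
with a limit at infinity). [folklore] -/
theorem integrableOn_mul_rescalingFactor (hc : Continuous c) {a : ℝ} (ha : 0 < a)
    (hca : ∀ s, 0 ≤ s → c s ≤ -a) {τ : ℝ} (hτ : 0 ≤ τ) :
    IntegrableOn (fun s => c s * rescalingFactor c s) (Ioi τ) :=
  integrableOn_Ioi_deriv_of_nonpos' (fun s _ => hasDerivAt_rescalingFactor hc s)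
    (fun _ hs => mul_rescalingFactor_nonpos ha hca (hτ.trans hs.out.le))
    (tendsto_rescalingFactor_atTop hc ha hca)

/-- **`C_ω(τ) = ∫_τ^∞ (−c_ω) C_ω`** for `τ ≥ 0` when `c_ω ≤ −a < 0` on `[0, ∞)` (improper FTC for
`C_ω' = c_ω C_ω` with `C_ω(∞) = 0`). [folklore] -/
theorem rescalingFactor_eq_integral_Ioi (hc : Continuous c) {a : ℝ} (ha : 0 < a)
    (hca : ∀ s, 0 ≤ s → c s ≤ -a) {τ : ℝ} (hτ : 0 ≤ τ) :
    rescalingFactor c τ = ∫ s in Ioi τ, -(c s * rescalingFactor c s) := by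
  have h := integral_Ioi_of_hasDerivAt_of_nonpos' (fun s _ => hasDerivAt_rescalingFactor hc s)
    (fun _ hs => mul_rescalingFactor_nonpos ha hca (hτ.trans hs.out.le))
    (tendsto_rescalingFactor_atTop hc ha hca)
  rw [MeasureTheory.integral_neg, h]
  ring

end Factor

/-! ### `T − t(τ)` and the two-sided comparison with `C_ω(τ)` -/

section Comparison

variable {c : ℝ → ℝ}

/-- `T − t(τ) = ∫_{(τ, ∞)} C` for `τ ≥ 0`, for any continuous factor integrable on `(0, ∞)`.
[folklore] -/
theorem blowupTime_sub_rescaledTime {C : ℝ → ℝ} (hint : IntegrableOn C (Ioi 0)) {τ : ℝ}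
    (hτ : 0 ≤ τ) : blowupTime C - rescaledTime C τ = ∫ s in Ioi τ, C s := by
  rw [blowupTime_eq, rescaledTime_apply]
  have h := integral_Ioi_sub_Ioi hint hτ
  linarith

/-- **Lower comparison `a (T − t(τ)) ≤ C_ω(τ)`** (`τ ≥ 0`) when `c_ω ≤ −a < 0` on `[0, ∞)`:
integrate `a C_ω ≤ (−c_ω) C_ω` over `(τ, ∞)`. [folklore] -/
theorem mul_sub_rescaledTime_le_rescalingFactor (hc : Continuous c) {a : ℝ} (ha : 0 < a)
    (hca : ∀ s, 0 ≤ s → c s ≤ -a) {τ : ℝ} (hτ : 0 ≤ τ) :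
    a * (blowupTime (rescalingFactor c) - rescaledTime (rescalingFactor c) τ) ≤
      rescalingFactor c τ := by
  have hint := integrableOn_rescalingFactor hc ha hca
  have hintτ : IntegrableOn (rescalingFactor c) (Ioi τ) := hint.mono_set (Ioi_subset_Ioi hτ)
  rw [blowupTime_sub_rescaledTime hint hτ, rescalingFactor_eq_integral_Ioi hc ha hca hτ,
    ← MeasureTheory.integral_const_mul]
  refine setIntegral_mono_on (hintτ.const_mul a) (integrableOn_mul_rescalingFactor hc ha hca hτ).neg
    measurableSet_Ioi fun s hs => ?_
  have hcs := hca s (hτ.trans hs.out.le)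
  have hC := rescalingFactor_pos c s
  nlinarith

/-- **Upper comparison `C_ω(τ) ≤ b (T − t(τ))`** (`τ ≥ 0`) when `−b ≤ c_ω ≤ −a < 0` on `[0, ∞)`:
integrate `(−c_ω) C_ω ≤ b C_ω` over `(τ, ∞)`. [folklore] -/
theorem rescalingFactor_le_mul_sub_rescaledTime (hc : Continuous c) {a b : ℝ} (ha : 0 < a)
    (hca : ∀ s, 0 ≤ s → c s ≤ -a) (hcb : ∀ s, 0 ≤ s → -b ≤ c s) {τ : ℝ} (hτ : 0 ≤ τ) :
    rescalingFactor c τ ≤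
      b * (blowupTime (rescalingFactor c) - rescaledTime (rescalingFactor c) τ) := by
  have hint := integrableOn_rescalingFactor hc ha hca
  have hintτ : IntegrableOn (rescalingFactor c) (Ioi τ) := hint.mono_set (Ioi_subset_Ioi hτ)
  rw [blowupTime_sub_rescaledTime hint hτ, rescalingFactor_eq_integral_Ioi hc ha hca hτ,
    ← MeasureTheory.integral_const_mul]
  refine setIntegral_mono_on (integrableOn_mul_rescalingFactor hc ha hca hτ).neg (hintτ.const_mul b)
    measurableSet_Ioi fun s hs => ?_
  have hcs := hcb s (hτ.trans hs.out.le)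
  have hC := rescalingFactor_pos c s
  nlinarith

/-- Two-sided form: `a (T − t(τ)) ≤ C_ω(τ) ≤ b (T − t(τ))` for `τ ≥ 0`, i.e. `C_ω ≍ T − t` — the
collapse clock of a dynamic-rescaling blow-up is comparable to the time to blow-up. [folklore] -/
theorem rescalingFactor_mem_Icc (hc : Continuous c) {a b : ℝ} (ha : 0 < a)
    (hca : ∀ s, 0 ≤ s → c s ≤ -a) (hcb : ∀ s, 0 ≤ s → -b ≤ c s) {τ : ℝ} (hτ : 0 ≤ τ) :
    rescalingFactor c τ ∈
      Icc (a * (blowupTime (rescalingFactor c) - rescaledTime (rescalingFactor c) τ))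
        (b * (blowupTime (rescalingFactor c) - rescaledTime (rescalingFactor c) τ)) :=
  ⟨mul_sub_rescaledTime_le_rescalingFactor hc ha hca hτ,
    rescalingFactor_le_mul_sub_rescaledTime hc ha hca hcb hτ⟩

end Comparison

/-! ### Transfer to physical time: the vorticity rate on `[0, T)` -/

section Physical

variable {c : ℝ → ℝ}

/-- Every physical time `s ∈ [0, T)` is a rescaled time `s = t(τ)` with `τ ≥ 0` (for a continuous
positive factor integrable on `(0, ∞)`; intermediate value theorem). [folklore] -/
theorem exists_rescaledTime_eq_of_mem_Ico {C : ℝ → ℝ} (hC : Continuous C)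
    (hint : IntegrableOn C (Ioi 0)) {s : ℝ} (hs : s ∈ Ico 0 (blowupTime C)) :
    ∃ τ, 0 ≤ τ ∧ rescaledTime C τ = s := by
  rcases hs.1.eq_or_lt with h0 | h0
  · exact ⟨0, le_rfl, by rw [rescaledTime_zero, h0]⟩
  · exact exists_ge_rescaledTime_eq (continuous_rescaledTime hC) (tendsto_rescaledTime hint) 0
      ⟨by rwa [rescaledTime_zero], hs.2⟩

/-- **Upper vorticity rate in physical time.** If `c_ω ≤ −a < 0` on `[0, ∞)` and a nonnegative
size functional `F` (e.g. `F t x = ‖ω(t, x)‖`) has BOUNDED rescaled profile,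
`C_ω(τ) F(t(τ), x) ≤ M` for all `τ ≥ 0` and all `x` (i.e. `‖ω̃(τ)‖_∞ ≤ M` by (4.1)), then
`(T − s) F(s, x) ≤ M / a` for every `s ∈ [0, T)` and every `x`: the blow-up is at most
self-similar-rate ("Type I in vorticity"). [folklore] -/
theorem sub_mul_le_of_rescaling (hc : Continuous c) {a : ℝ} (ha : 0 < a)
    (hca : ∀ s, 0 ≤ s → c s ≤ -a) {X : Type*} {F : ℝ → X → ℝ} (hF0 : ∀ s x, 0 ≤ F s x) {M : ℝ}
    (hF : ∀ τ, 0 ≤ τ → ∀ x, rescalingFactor c τ * F (rescaledTime (rescalingFactor c) τ) x ≤ M)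
    {s : ℝ} (hs : s ∈ Ico 0 (blowupTime (rescalingFactor c))) (x : X) :
    (blowupTime (rescalingFactor c) - s) * F s x ≤ M / a := by
  obtain ⟨τ, hτ, rfl⟩ := exists_rescaledTime_eq_of_mem_Ico (continuous_rescalingFactor hc)
    (integrableOn_rescalingFactor hc ha hca) hs
  have h1 := mul_sub_rescaledTime_le_rescalingFactor hc ha hca hτ
  have h2 := hF τ hτ x
  have h3 := hF0 (rescaledTime (rescalingFactor c) τ) x
  rw [le_div_iff₀ ha]
  calc (blowupTime (rescalingFactor c) - rescaledTime (rescalingFactor c) τ) *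
        F (rescaledTime (rescalingFactor c) τ) x * a
      = a * (blowupTime (rescalingFactor c) - rescaledTime (rescalingFactor c) τ) *
        F (rescaledTime (rescalingFactor c) τ) x := by ring
    _ ≤ rescalingFactor c τ * F (rescaledTime (rescalingFactor c) τ) x :=
        mul_le_mul_of_nonneg_right h1 h3
    _ ≤ M := h2

/-- The same in the filter shape `∀ᶠ s in 𝓝[<] T` (as `s ↑ T = t(∞)`). [folklore] -/
theorem eventually_sub_mul_le_of_rescaling (hc : Continuous c) {a : ℝ} (ha : 0 < a)
    (hca : ∀ s, 0 ≤ s → c s ≤ -a) {X : Type*} {F : ℝ → X → ℝ} (hF0 : ∀ s x, 0 ≤ F s x) {M : ℝ}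
    (hF : ∀ τ, 0 ≤ τ → ∀ x, rescalingFactor c τ * F (rescaledTime (rescalingFactor c) τ) x ≤ M) :
    ∀ᶠ s in 𝓝[<] (blowupTime (rescalingFactor c)), ∀ x,
      (blowupTime (rescalingFactor c) - s) * F s x ≤ M / a := by
  have hT := blowupTime_pos (continuous_rescalingFactor hc) (rescalingFactor_pos c)
    (integrableOn_rescalingFactor hc ha hca)
  refine mem_nhdsLT_iff_exists_Ioo_subset.2 ⟨0, hT, fun s hs x => ?_⟩
  exact sub_mul_le_of_rescaling hc ha hca hF0 hF ⟨hs.1.le, hs.2⟩ x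

/-- **Lower vorticity rate in physical time at the tracked points.** If `−b ≤ c_ω ≤ −a < 0` on
`[0, ∞)` and the rescaled profile stays NONTRIVIAL inside `Ω`, `m ≤ C_ω(τ) F(t(τ), x_τ)` with
`m > 0` at some `x_τ ∈ Ω` for every `τ ≥ 0`, then at every physical time `s ∈ [0, T)` some point of
`Ω` has `m / b ≤ (T − s) F(s, x)`: the blow-up is at least self-similar-rate. [folklore] -/
theorem le_sub_mul_of_rescaling (hc : Continuous c) {a b : ℝ} (ha : 0 < a) (hb : 0 < b)
    (hca : ∀ s, 0 ≤ s → c s ≤ -a) (hcb : ∀ s, 0 ≤ s → -b ≤ c s) {X : Type*} {Ω : Set X}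
    {F : ℝ → X → ℝ} {m : ℝ} (hm : 0 < m)
    (hF : ∀ τ, 0 ≤ τ → ∃ x ∈ Ω, m ≤ rescalingFactor c τ * F (rescaledTime (rescalingFactor c) τ) x)
    {s : ℝ} (hs : s ∈ Ico 0 (blowupTime (rescalingFactor c))) :
    ∃ x ∈ Ω, m / b ≤ (blowupTime (rescalingFactor c) - s) * F s x := by
  obtain ⟨τ, hτ, rfl⟩ := exists_rescaledTime_eq_of_mem_Ico (continuous_rescalingFactor hc)
    (integrableOn_rescalingFactor hc ha hca) hs
  obtain ⟨x, hx, hmx⟩ := hF τ hτ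
  refine ⟨x, hx, ?_⟩
  have h1 := rescalingFactor_le_mul_sub_rescaledTime hc ha hca hcb hτ
  have hC := rescalingFactor_pos c τ
  -- `m > 0` and `C > 0` force `F ≥ 0` at the tracked point
  have hF0 : 0 ≤ F (rescaledTime (rescalingFactor c) τ) x := by
    by_contra hneg
    have : rescalingFactor c τ * F (rescaledTime (rescalingFactor c) τ) x < 0 :=
      mul_neg_of_pos_of_neg hC (not_le.1 hneg)
    linarith
  rw [div_le_iff₀ hb]
  calc m ≤ rescalingFactor c τ * F (rescaledTime (rescalingFactor c) τ) x := hmx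
    _ ≤ b * (blowupTime (rescalingFactor c) - rescaledTime (rescalingFactor c) τ) *
        F (rescaledTime (rescalingFactor c) τ) x := mul_le_mul_of_nonneg_right h1 hF0
    _ = (blowupTime (rescalingFactor c) - rescaledTime (rescalingFactor c) τ) *
        F (rescaledTime (rescalingFactor c) τ) x * b := by ring

end Physical

/-! ### The route's vorticity-rate conjunct -/

section Vorticity

variable {c : ℝ → ℝ}

/-- **A bounded rescaled vorticity profile with `c_ω ≤ −a < 0` blows up at vorticity-Type-I rate.**
If `C_ω(τ) ‖curl u(t(τ), x)‖ ≤ M` for all `τ ≥ 0`, `x ∈ ℝ³` (bounded rescaled profile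
`‖ω̃(τ)‖_∞ ≤ M`, [ChenHou2021Boundary] (4.1)), then with `T = t(∞)`:
`∃ C, ∀ᶠ t in 𝓝[<] T, ∀ x, (T − t) ‖curl u(t, x)‖ ≤ C` (namely `C = M / a`) — the rate conjunct of
`CertifiedBlowupVorticityRateBlowup` (route CertifiedBlowup, NavierStokesRegularity). [folklore] -/
theorem vorticityRate_of_rescaling (hc : Continuous c) {a : ℝ} (ha : 0 < a)
    (hca : ∀ s, 0 ≤ s → c s ≤ -a)
    {u : ℝ → EuclideanSpace ℝ (Fin 3) → EuclideanSpace ℝ (Fin 3)} {M : ℝ}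
    (hM : ∀ τ, 0 ≤ τ → ∀ x : EuclideanSpace ℝ (Fin 3),
      rescalingFactor c τ * ‖curl (u (rescaledTime (rescalingFactor c) τ)) x‖ ≤ M) :
    ∃ C : ℝ, ∀ᶠ t in 𝓝[<] (blowupTime (rescalingFactor c)), ∀ x : EuclideanSpace ℝ (Fin 3),
      (blowupTime (rescalingFactor c) - t) * ‖curl (u t) x‖ ≤ C :=
  ⟨M / a, eventually_sub_mul_le_of_rescaling hc ha hca (F := fun s x => ‖curl (u s) x‖)
    (fun _ _ => norm_nonneg _) hM⟩

end Vorticity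

end Literature.Analysis.FluidPDE
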